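import Literature.Combinatorics.Sahi2008.MeasureFunctional
import Literature.Combinatorics.Sahi2008.FKGCumulation
import Literature.Probability.Percolation.StrongHarrisThreePointFKG
import Literature.Probability.Percolation.KozmaNitzanPreFKG
import Summits.CriticalPhenomena.PercolationContinuityZ3.Theorems.SahiConjecture
import Summits.CriticalPhenomena.PercolationContinuityZ3.Theorems.SahiThreeCoordinatesDual

/-!
# Sahi positivity for finite measures with FKG point weights — random-cluster measures `q ≥ 1`, FK–Ising

Cell `prim-sahi`, typer, generation 9 (`--supports stmt-CriticalPhenomena-4575`).  Theorems only (no
definitions, no named facts, no sorries).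

Every theorem of `Literature/Combinatorics/Sahi2008/` with an `IsFKGMeasure` hypothesis is a statement about a
probability WEIGHT `μ : α → ℝ` on a finite distributive lattice.  A finite MEASURE `ν` on a finite measurable
type with measurable singletons is the weighted sum of Dirac masses of its point weights `a ↦ ν{a}`, so the
measure-level functional `msahiE ν n f` (Lieb–Sahi's `E_n` "for functions on a probability space",
`MeasureFunctional.lean`) IS the finite-weight functional `sahiE (a ↦ ν.real {a}) n f`
(`msahiE_eq_sahiE_real_singleton`).  Consequently, for every finite measure `ν` whose point weights form an
FKG probability weight — by the literature seat's `isFKGMeasure_rcMeasure` this includes the TREE's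
random-cluster measures `φ^B_{G,p,q} = rcMeasure G p q B` for `0 ≤ p ≤ 1`, `q ≥ 1` and every wired set `B`,
in particular FK–Ising `q = 2`, `p = 1 − e^{−2β}` —

* UNCONDITIONALLY, every `n` (Sahi's Theorem 2 / Blinovsky's theorem WITH TWO FREE SLOTS,
  `sahiE_nonneg_of_isLatticeCumulation_offTwo`): `0 ≤ E_n(f_0,…,f_{n−1})` whenever at most two slots are
  arbitrary nonnegative increasing functions and every other slot is a lattice cumulation — on bond
  configurations: a nonnegative combination of indicators `1_{F ⊆ ω}` of "all edges of `F` are open"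
  (`msahiE_nonneg_offTwo_of_isFKGMeasure`, `msahiE_nonneg_openEdges_offTwo`,
  `rcMeasure_msahiE_nonneg_openEdges_offTwo`, `fkIsing_msahiE_nonneg_openEdges_offTwo`); the case `n = 3`
  displayed: `0 ≤ E_3({F open}, A, B) = 2φ(O_F ∩ A ∩ B) + φ(O_F)φ(A)φ(B) − φ(O_F)φ(A ∩ B) − φ(A)φ(O_F ∩ B)
  − φ(B)φ(O_F ∩ A)` for increasing events `A, B` (`sahiE3_openEdges_nonneg`, `rcMeasure_sahiE3_openEdges_nonneg`);
* CONDITIONALLY on Sahi's conjecture `C_n` (`SahiConjecture n`, the cell's typed obligation): `E_n ≥ 0` for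
  ALL nonnegative increasing, resp. decreasing, families (`msahiE_nonneg_of_sahiConjecture(_antitone)`,
  `mSahiPositive_of_sahiConjecture`, `rcMeasure_msahiE_nonneg_of_sahiConjecture(_antitone)`,
  `rcMeasure_mSahiPositive_of_sahiConjecture`).

None of these is in print for the random-cluster model (Ayyer–Linusson–Ravichandran 2025 have only the
degree-2 three-point inequality, Thm. 2.10 = the tree's `rcMeasure_threePoint_strongHarris`); at `q = 1` the
unconditional part is Sahi's Theorem 2 with two free slots for Bernoulli percolation
(`SahiInfiniteVolume.msahiE_bondPercolation_nonneg_openEdges_offTwo`, there for every graph).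
-/

noncomputable section

namespace Summit.CriticalPhenomena.PercolationContinuityZ3.Theorems.SahiFKGBondMeasures

open MeasureTheory Finset Literature.Combinatorics.Sahi2008
open Literature.Probability.LatticeModels Literature.Probability.Percolation

/-! ### Finite measures on finite types: `msahiE` is `sahiE` of the point weights -/

section Bridge

variable {α : Type*} [Fintype α] [MeasurableSpace α] [MeasurableSingletonClass α]

/-- **The measure-level `E_n` of a finite measure on a finite type is the finite-weight `E_n` of its point
weights** `a ↦ ν{a}` (every integral is the finite weighted sum). -/
theorem msahiE_eq_sahiE_real_singleton (ν : Measure α) [IsFiniteMeasure ν] (n : ℕ) (f : Fin n → α → ℝ) :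
    msahiE ν n f = sahiE (fun a => ν.real {a}) n f :=
  msahiE_eq_sahiE_of_moments ν _ f f fun S => by
    rw [integral_fintype Integrable.of_finite, ex]
    simp only [smul_eq_mul]

variable [DistribLattice α]

open scoped Classical in
/-- **Sahi's Theorem 2 / Blinovsky's theorem with two free slots, for finite measures with FKG point weights**
(unconditional, every `n`): if the point weights of `ν` form an FKG probability weight on the finite distributive
lattice `α`, then `0 ≤ E_n(f_0,…,f_{n−1})` for nonnegative monotone `f_i` all of which, except at most two, are
lattice cumulations (nonnegative combinations of indicators of principal up-sets). -/
theorem msahiE_nonneg_offTwo_of_isFKGMeasure (ν : Measure α) [IsFiniteMeasure ν]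
    (hν : IsFKGMeasure fun a => ν.real {a}) {n : ℕ} (f : Fin n → α → ℝ) (hf0 : ∀ i x, 0 ≤ f i x)
    (hfm : ∀ i, Monotone (f i)) (J : Finset (Fin n)) (hJ : J.card ≤ 2)
    (hcum : ∀ i, i ∉ J → IsLatticeCumulation (f i)) : 0 ≤ msahiE ν n f := by
  rw [msahiE_eq_sahiE_real_singleton]
  exact sahiE_nonneg_of_isLatticeCumulation_offTwo hν f hf0 hfm J hJ hcum

/-- **`C_n` ⇒ Sahi positivity of every finite measure with FKG point weights** (increasing families): under
`SahiConjecture n`, `0 ≤ E_n(f_0,…,f_{n−1})` for all nonnegative monotone increasing `f_i`. -/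
theorem msahiE_nonneg_of_sahiConjecture {α : Type} [Fintype α] [MeasurableSpace α]
    [MeasurableSingletonClass α] [DistribLattice α] {n : ℕ} (h : SahiConjecture n) (ν : Measure α)
    [IsFiniteMeasure ν] (hν : IsFKGMeasure fun a => ν.real {a}) (f : Fin n → α → ℝ)
    (hf0 : ∀ i x, 0 ≤ f i x) (hfm : ∀ i, Monotone (f i)) : 0 ≤ msahiE ν n f := by
  rw [msahiE_eq_sahiE_real_singleton]
  exact h α _ hν f hf0 hfm

/-- **`C_n` ⇒ Sahi positivity of every finite measure with FKG point weights, decreasing families** (the FKG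
lattice condition is self-dual). -/
theorem msahiE_nonneg_of_sahiConjecture_antitone {α : Type} [Fintype α] [MeasurableSpace α]
    [MeasurableSingletonClass α] [DistribLattice α] {n : ℕ} (h : SahiConjecture n) (ν : Measure α)
    [IsFiniteMeasure ν] (hν : IsFKGMeasure fun a => ν.real {a}) (f : Fin n → α → ℝ)
    (hf0 : ∀ i x, 0 ≤ f i x) (hfa : ∀ i, Antitone (f i)) : 0 ≤ msahiE ν n f := by
  rw [msahiE_eq_sahiE_real_singleton, ← SahiThreeCoordinates.sahiE_dual]
  exact h αᵒᵈ _ (SahiThreeCoordinates.isFKGMeasure_dual hν) _ (fun i x => hf0 i _)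
    fun i => (hfa i).dual_left

/-- **`C_n` ⇒ `MSahiPositive ν n`** for every finite measure with FKG point weights. -/
theorem mSahiPositive_of_sahiConjecture {α : Type} [Fintype α] [MeasurableSpace α]
    [MeasurableSingletonClass α] [DistribLattice α] {n : ℕ} (h : SahiConjecture n) (ν : Measure α)
    [IsFiniteMeasure ν] (hν : IsFKGMeasure fun a => ν.real {a}) : MSahiPositive ν n :=
  fun f hf0 hfm => msahiE_nonneg_of_sahiConjecture h ν hν f hf0 hfm

end Bridge

/-! ### Bond configurations: open-edge cylinders are cumulations -/

section Bond

open scoped Classical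

variable {V : Type*} [Fintype V]

/-- The indicator of "all edges of `F` are open", `1_{F ⊆ ω}`, is the indicator of the principal up-set of `F`
in the lattice `2^{Sym2 V}` — a lattice cumulation. -/
theorem isLatticeCumulation_indicator_openEdges (F : Set (Sym2 V)) :
    IsLatticeCumulation ({ω : BondConfig V | F ⊆ ω}.indicator (1 : BondConfig V → ℝ)) := by
  have h : {ω : BondConfig V | F ⊆ ω}.indicator (1 : BondConfig V → ℝ) = setInd (principalUp F) := by
    funext ω
    by_cases hF : F ⊆ ω
    · rw [Set.indicator_of_mem (show ω ∈ {ω' : BondConfig V | F ⊆ ω'} from hF), Pi.one_apply, setInd_apply,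
        if_pos (by rw [mem_principalUp]; exact hF)]
    · rw [Set.indicator_of_notMem (show ω ∉ {ω' : BondConfig V | F ⊆ ω'} from hF), setInd_apply,
        if_neg (by rw [mem_principalUp]; exact hF)]
  rw [h]
  exact isLatticeCumulation_setInd_principalUp F

/-- More generally, every nonnegative combination `ω ↦ Σ_F c(F)·1_{F ⊆ ω}` (`c ≥ 0`; e.g. the number of open
edges in a fixed set, the number of fully open sets among a fixed list) is a lattice cumulation. -/
theorem isLatticeCumulation_sum_indicator_openEdges (c : Set (Sym2 V) → ℝ) (hc : ∀ F, 0 ≤ c F) :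
    IsLatticeCumulation (fun ω : BondConfig V =>
      ∑ F, c F * {ω' : BondConfig V | F ⊆ ω'}.indicator (1 : BondConfig V → ℝ) ω) := by
  refine ⟨c, hc, funext fun ω => Finset.sum_congr rfl fun F _ => ?_⟩
  by_cases hF : F ⊆ ω
  · rw [Set.indicator_of_mem (show ω ∈ {ω' : BondConfig V | F ⊆ ω'} from hF), Pi.one_apply, mul_one,
      if_pos hF]
  · rw [Set.indicator_of_notMem (show ω ∉ {ω' : BondConfig V | F ⊆ ω'} from hF), mul_zero, if_neg hF]

/-- **Two free slots, bond measures with FKG point weights** (unconditional, every `n`): for a finite measure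
`ν` on `BondConfig V` whose point weights form an FKG probability weight, `0 ≤ E_n(f_0,…,f_{n−1})` whenever at
most two slots (`J`, `|J| ≤ 2`) are arbitrary nonnegative increasing functions and every other slot is the
indicator of "all edges of `F_k` are open".  E.g. `n = 4`: `0 ≤ E_4(1_A, 1_B, 1_{F open}, 1_{F' open})`. -/
theorem msahiE_nonneg_openEdges_offTwo (ν : Measure (BondConfig V)) [IsFiniteMeasure ν]
    (hν : IsFKGMeasure fun S : BondConfig V => ν.real {S}) {n : ℕ} (J : Finset (Fin n)) (hJ : J.card ≤ 2)
    (f : Fin n → BondConfig V → ℝ) (hf0 : ∀ k, k ∈ J → ∀ ω, 0 ≤ f k ω)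
    (hmono : ∀ k, k ∈ J → Monotone (f k)) (F : Fin n → Set (Sym2 V))
    (hcyl : ∀ k, k ∉ J → f k = {ω : BondConfig V | F k ⊆ ω}.indicator 1) : 0 ≤ msahiE ν n f := by
  refine msahiE_nonneg_offTwo_of_isFKGMeasure ν hν f (fun k ω => ?_) (fun k => ?_) J hJ fun k hk => ?_
  · by_cases hk : k ∈ J
    · exact hf0 k hk ω
    · rw [hcyl k hk]
      exact Set.indicator_nonneg (fun _ _ => zero_le_one) ω
  · by_cases hk : k ∈ J
    · exact hmono k hk
    · rw [hcyl k hk]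
      exact KNPreFKG.monotone_indicator_one_of_isUpperSet
        fun ω ω' hωω' (hω : F k ⊆ ω) => hω.trans hωω'
  · rw [hcyl k hk]
    exact isLatticeCumulation_indicator_openEdges (F k)

/-- **`n = 3` displayed**: for a finite measure `ν` on `BondConfig V` with FKG point weights, a set of edges
`F` with `O_F = {ω : F ⊆ ω}` and increasing events `A, B`:
`0 ≤ E_3(1_{O_F}, 1_A, 1_B) = 2ν(O_F ∩ A ∩ B) + ν(O_F)ν(A)ν(B) − (ν(O_F)ν(A ∩ B) + ν(A)ν(O_F ∩ B) +
ν(B)ν(O_F ∩ A))` (the event-level `sahiE3`). -/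
theorem sahiE3_openEdges_nonneg (ν : Measure (BondConfig V)) [IsFiniteMeasure ν]
    (hν : IsFKGMeasure fun S : BondConfig V => ν.real {S}) (F : Set (Sym2 V)) {A B : Set (BondConfig V)}
    (hA : IsUpperSet A) (hB : IsUpperSet B) : 0 ≤ sahiE3 ν {ω : BondConfig V | F ⊆ ω} A B := by
  rw [← msahiE_three_indicator ν (Set.toFinite _).measurableSet (Set.toFinite _).measurableSet
    (Set.toFinite _).measurableSet]
  refine msahiE_nonneg_openEdges_offTwo ν hν ({1, 2} : Finset (Fin 3)) (by decide) _ ?_ ?_ ![F, F, F] ?_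
  · intro k hk ω
    fin_cases k
    · simp at hk
    · exact Set.indicator_nonneg (fun _ _ => zero_le_one) ω
    · exact Set.indicator_nonneg (fun _ _ => zero_le_one) ω
  · intro k hk
    fin_cases k
    · simp at hk
    · exact KNPreFKG.monotone_indicator_one_of_isUpperSet hA
    · exact KNPreFKG.monotone_indicator_one_of_isUpperSet hB
  · intro k hk
    fin_cases k
    · rfl
    · simp at hk
    · simp at hk

end Bond

/-! ### The random-cluster measures `φ^B_{G,p,q}`, `q ≥ 1`, and FK–Ising -/

section RandomCluster

open scoped Classical

variable {V : Type*} [Fintype V] [DecidableEq V] (G : SimpleGraph V) [DecidableRel G.Adj]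

/-- **Random-cluster model, two free slots, unconditional, every `n`**: for `0 ≤ p ≤ 1`, `q ≥ 1`, any wired set
`B`, `0 ≤ E_n(f_0,…,f_{n−1})` under `φ^B_{G,p,q}` whenever at most two slots are arbitrary nonnegative
increasing functions and the others are indicators of "all edges of `F_k` are open". -/
theorem rcMeasure_msahiE_nonneg_openEdges_offTwo {p q : ℝ} (hp : p ∈ Set.Icc (0 : ℝ) 1) (hq : 1 ≤ q)
    (B : Set V) {n : ℕ} (J : Finset (Fin n)) (hJ : J.card ≤ 2) (f : Fin n → BondConfig V → ℝ)
    (hf0 : ∀ k, k ∈ J → ∀ ω, 0 ≤ f k ω) (hmono : ∀ k, k ∈ J → Monotone (f k)) (F : Fin n → Set (Sym2 V))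
    (hcyl : ∀ k, k ∉ J → f k = {ω : BondConfig V | F k ⊆ ω}.indicator 1) :
    0 ≤ msahiE (rcMeasure G p q B) n f := by
  haveI := isProbabilityMeasure_rcMeasure G hp (one_pos.trans_le hq) B
  exact msahiE_nonneg_openEdges_offTwo _ (isFKGMeasure_rcMeasure G hp hq B) J hJ f hf0 hmono F hcyl

/-- **Random-cluster model, `n = 3` displayed**: for `0 ≤ p ≤ 1`, `q ≥ 1`, any wired set `B`, a set of edges
`F` (`O_F = {F open}`) and increasing events `A, B'`:
`0 ≤ 2φ(O_F ∩ A ∩ B') + φ(O_F)φ(A)φ(B') − (φ(O_F)φ(A ∩ B') + φ(A)φ(O_F ∩ B') + φ(B')φ(O_F ∩ A))`. -/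
theorem rcMeasure_sahiE3_openEdges_nonneg {p q : ℝ} (hp : p ∈ Set.Icc (0 : ℝ) 1) (hq : 1 ≤ q)
    (B : Set V) (F : Set (Sym2 V)) {A B' : Set (BondConfig V)} (hA : IsUpperSet A) (hB' : IsUpperSet B') :
    0 ≤ 2 * (rcMeasure G p q B).real ({ω | F ⊆ ω} ∩ A ∩ B') +
        (rcMeasure G p q B).real {ω | F ⊆ ω} * (rcMeasure G p q B).real A * (rcMeasure G p q B).real B' -
        ((rcMeasure G p q B).real {ω | F ⊆ ω} * (rcMeasure G p q B).real (A ∩ B') +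
          (rcMeasure G p q B).real A * (rcMeasure G p q B).real ({ω | F ⊆ ω} ∩ B') +
          (rcMeasure G p q B).real B' * (rcMeasure G p q B).real ({ω | F ⊆ ω} ∩ A)) := by
  haveI := isProbabilityMeasure_rcMeasure G hp (one_pos.trans_le hq) B
  have h := sahiE3_openEdges_nonneg _ (isFKGMeasure_rcMeasure G hp hq B) F hA hB'
  rwa [sahiE3_def] at h

/-- **`C_n` ⇒ the random-cluster measures with `q ≥ 1` are Sahi-positive of order `n`** (increasing families):
under `SahiConjecture n`, for `0 ≤ p ≤ 1`, `q ≥ 1`, any wired set, all nonnegative increasing `f_i`,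
`0 ≤ E_n(f_0,…,f_{n−1})` under `φ^B_{G,p,q}`. -/
theorem rcMeasure_msahiE_nonneg_of_sahiConjecture {V : Type} [Fintype V] [DecidableEq V]
    (G : SimpleGraph V) [DecidableRel G.Adj] {n : ℕ} (h : SahiConjecture n) {p q : ℝ}
    (hp : p ∈ Set.Icc (0 : ℝ) 1) (hq : 1 ≤ q) (B : Set V) (f : Fin n → BondConfig V → ℝ)
    (hf0 : ∀ i ω, 0 ≤ f i ω) (hfm : ∀ i, Monotone (f i)) : 0 ≤ msahiE (rcMeasure G p q B) n f := by
  haveI := isProbabilityMeasure_rcMeasure G hp (one_pos.trans_le hq) B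
  exact msahiE_nonneg_of_sahiConjecture h _ (isFKGMeasure_rcMeasure G hp hq B) f hf0 hfm

/-- **`C_n` ⇒ random-cluster Sahi positivity, decreasing families** (e.g. indicators of "all edges of `F`
closed", of disconnections `{a ↮ b}`). -/
theorem rcMeasure_msahiE_nonneg_of_sahiConjecture_antitone {V : Type} [Fintype V] [DecidableEq V]
    (G : SimpleGraph V) [DecidableRel G.Adj] {n : ℕ} (h : SahiConjecture n) {p q : ℝ}
    (hp : p ∈ Set.Icc (0 : ℝ) 1) (hq : 1 ≤ q) (B : Set V) (f : Fin n → BondConfig V → ℝ)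
    (hf0 : ∀ i ω, 0 ≤ f i ω) (hfa : ∀ i, Antitone (f i)) : 0 ≤ msahiE (rcMeasure G p q B) n f := by
  haveI := isProbabilityMeasure_rcMeasure G hp (one_pos.trans_le hq) B
  exact msahiE_nonneg_of_sahiConjecture_antitone h _ (isFKGMeasure_rcMeasure G hp hq B) f hf0 hfa

/-- **`C_n` ⇒ `MSahiPositive φ^B_{G,p,q} n`** (`0 ≤ p ≤ 1`, `q ≥ 1`, any wired set). -/
theorem rcMeasure_mSahiPositive_of_sahiConjecture {V : Type} [Fintype V] [DecidableEq V]
    (G : SimpleGraph V) [DecidableRel G.Adj] {n : ℕ} (h : SahiConjecture n) {p q : ℝ}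
    (hp : p ∈ Set.Icc (0 : ℝ) 1) (hq : 1 ≤ q) (B : Set V) : MSahiPositive (rcMeasure G p q B) n :=
  fun f hf0 hfm => rcMeasure_msahiE_nonneg_of_sahiConjecture G h hp hq B f hf0 hfm

/-- **FK–Ising (`q = 2`, `p = 1 − e^{−2β}`, `β ≥ 0`), two free slots, unconditional, every `n`.** -/
theorem fkIsing_msahiE_nonneg_openEdges_offTwo {β : ℝ} (hβ : 0 ≤ β) (B : Set V) {n : ℕ}
    (J : Finset (Fin n)) (hJ : J.card ≤ 2) (f : Fin n → BondConfig V → ℝ)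
    (hf0 : ∀ k, k ∈ J → ∀ ω, 0 ≤ f k ω) (hmono : ∀ k, k ∈ J → Monotone (f k)) (F : Fin n → Set (Sym2 V))
    (hcyl : ∀ k, k ∉ J → f k = {ω : BondConfig V | F k ⊆ ω}.indicator 1) :
    0 ≤ msahiE (rcMeasure G (fkIsingParam β) 2 B) n f :=
  rcMeasure_msahiE_nonneg_openEdges_offTwo G (fkIsingParam_mem_Icc hβ) (by norm_num) B J hJ f hf0 hmono F
    hcyl

/-- **`C_n` ⇒ FK–Ising Sahi positivity of order `n`** (`β ≥ 0`, any wired set). -/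
theorem fkIsing_mSahiPositive_of_sahiConjecture {V : Type} [Fintype V] [DecidableEq V]
    (G : SimpleGraph V) [DecidableRel G.Adj] {n : ℕ} (h : SahiConjecture n) {β : ℝ} (hβ : 0 ≤ β)
    (B : Set V) : MSahiPositive (rcMeasure G (fkIsingParam β) 2 B) n :=
  rcMeasure_mSahiPositive_of_sahiConjecture G h (fkIsingParam_mem_Icc hβ) (by norm_num) B

end RandomCluster

end Summit.CriticalPhenomena.PercolationContinuityZ3.Theorems.SahiFKGBondMeasures
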